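import Summits.AtomisticToContinuum.Crystallization.Theses.ReggeStarCoercivity
import Summits.AtomisticToContinuum.Crystallization.Theorems.DefectFreeCrystallizes.Negative.FccBall
import Literature.MathematicalPhysics.StatisticalMechanics.BarlowStacking
import Literature.MathematicalPhysics.StatisticalMechanics.MuGroundStateConfiguration

/-!
# Negative knowledge for crux `DefectFreeCrystallizes` — the line's transfer target `SqueezeWindow`
# is FALSE without exact minimality (standing disprover, gen 3; supports stmt-AtomisticToContinuum-13603)

Line `octet-cell-squeeze` (skeleton `Cruxes/DefectFreeCrystallizes/Lines/octet-cell-squeeze.lean`) routes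
the crux through `SqueezeWindow` (C⁺): ONE band map `G₀` such that every all-good `(R+3)`-ball of every
Lennard-Jones GROUND STATE contains an `r`-sub-ball two-way `ε`-matched to a rigid image of the strained
hcp crystal `G₀ · hcpStacking 1 hIdeal`.  Here: the same statement with `IsGroundState lennardJones x`
replaced by `Function.Injective x` (`SqueezeWindowWithoutGroundStates`, everything else verbatim,
`Good` = `Negative.PredicateAPI.Good`) is FALSE — `squeezeWindow_false_without_groundStates`.

Witness: balls of the fcc LATTICE in cubic coordinates (`fccBall M`: all even-sum integer vectors `v`
with `‖v/√2‖ ≤ M`); every site at depth `≥ 3` is good at scale `1` with the identity isometry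
(`good_fccBall`: its `6/5`-shell IS `fccKissingPattern`).  fcc is closed under point reflections
`2p − q` (`reflect_mem_range_fccBall`), hcp is not: reflecting `q` through the point `q'` of the next
layer above the same `(i, j)` lands at lateral offset `±2w` from layer `k+2`, at squared distance `≥ 1/3`
from the stacking (`hcp_reflection_far`).  A two-way `1/10`-matching on a ball of radius `7` transports
the reflection through the band map (`17/20 ≤ ‖G₀u‖/‖u‖ ≤ 6/5`) and forces an hcp point within
`8/17 < 1/√3` of `2q' − q` — contradiction.

CONSEQUENCE (load-bearing analysis for the line): the hcp-exactness of C⁺ is carried ENTIRELY by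
`IsGroundState`, through `stub_windowPinning` and the registry gap `γ' = 10⁻⁵` of `stub_registryLandscape`;
an all-good fcc region of radius `R(ε, r) + 3` in any LJ ground state refutes `SqueezeWindow`, so the line
bets that `R(ε, r)` exceeds the largest all-good fcc ball of every LJ ground state (physically
`~ Δγ_surface/|J₂| ~ 10²–10³` spacings: fcc / Marks-decahedral morphologies are the expected LJ cluster
minima up to `N ~ 10⁵–10⁷`), i.e. on the size of its own constant `C_Q/γ'`.
-/

noncomputable section

namespace Summit.AtomisticToContinuum.Crystallization.Theorems.DefectFreeCrystallizes.Negative.SqueezeWindowNeedsMinimality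

open Literature.MathematicalPhysics.StatisticalMechanics Literature.Geometry.DiscreteGeometry
open Summit.AtomisticToContinuum.Crystallization.Theorems.DefectFreeCrystallizes.Negative
open Summit.AtomisticToContinuum.Crystallization.Theorems.DefectFreeCrystallizes.Negative.FccBall
open Filter Topology

local notation "E3" => EuclideanSpace ℝ (Fin 3)

/-- [verbatim copy of the line's `InBand`] -/
def InBand (G : E3 →L[ℝ] E3) : Prop :=
  ∀ u : E3, (17 / 20) * ‖u‖ ≤ ‖G u‖ ∧ ‖G u‖ ≤ (6 / 5) * ‖u‖

/-- [verbatim copy of the line's `hIdeal`] -/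
def hIdeal : ℝ := Real.sqrt (2 / 3)

/-- The line's transfer target `SqueezeWindow` with `IsGroundState lennardJones x` REPLACED by
`Function.Injective x` (everything else verbatim, `Good` = `Negative.PredicateAPI.Good`). -/
def SqueezeWindowWithoutGroundStates : Prop :=
  ∃ G₀ : E3 →L[ℝ] E3, InBand G₀ ∧
    ∀ ε r : ℝ, 0 < ε → 0 < r → ∃ R : ℝ, r ≤ R ∧
      ∀ (N : ℕ) (x : Fin N → E3), Function.Injective x →
        ∀ c : E3, (∃ j : Fin N, dist (x j) c ≤ 1) → (∀ j : Fin N, dist (x j) c ≤ R + 3 → PredicateAPI.Good x j) →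
          ∃ (c' : E3) (A : E3 →ₗᵢ[ℝ] E3) (t : E3), dist c' c + r ≤ R ∧
            BallMatch ε r c' (Set.range x) ((fun p => A (G₀ p) + t) '' hcpStacking 1 hIdeal)

/-! ### hcp is not closed under reflection through an interlayer neighbour -/

/-- `hIdeal² = 2/3`. [folklore] -/
theorem hIdeal_sq : hIdeal ^ 2 = 2 / 3 := Real.sq_sqrt (by norm_num)

/-- `hIdeal > 0`. [folklore] -/
theorem hIdeal_pos : 0 < hIdeal := Real.sqrt_pos.2 (by norm_num)

/-- Labels of the alternating (hcp) sequence at `k`, `k+1`, `k+2`. -/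
theorem haggLabel_alt_triple (k : ℤ) :
    (haggLabel alternatingHagg k = 0 ∧ haggLabel alternatingHagg (k + 1) = 1 ∧ haggLabel alternatingHagg (k + 2) = 0) ∨
    (haggLabel alternatingHagg k = 1 ∧ haggLabel alternatingHagg (k + 1) = 0 ∧ haggLabel alternatingHagg (k + 2) = 1) := by
  simp only [haggLabel_alternating]
  by_cases hk : Even k
  · left
    have h1 : ¬ Even (k + 1) := Int.not_even_iff_odd.2 (hk.add_one)
    have h2 : Even (k + 2) := hk.add (by decide)
    simp [hk, h1, h2]
  · right
    have hk' : Odd k := Int.not_even_iff_odd.1 hk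
    have h1 : Even (k + 1) := hk'.add_one
    have h2 : ¬ Even (k + 2) := fun h => hk (by simpa using h.sub (show Even (2 : ℤ) by decide))
    simp [hk, h1, h2]

/-- The integer quadratic form behind the lateral offset `−2w`. -/
theorem lateral_form_ge (m n : ℤ) : (1 : ℝ) / 3 ≤ ((m : ℝ) + n / 2 - 1) ^ 2 + 3 / 4 * ((n : ℝ) - 2 / 3) ^ 2 := by
  rcases eq_or_ne n 1 with rfl | hn
  · have h1 : (1 : ℤ) ≤ (2 * m - 1) ^ 2 := by
      rcases le_or_gt 1 m with h | h <;> nlinarith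
    have h1' : (1 : ℝ) ≤ (2 * (m : ℝ) - 1) ^ 2 := by exact_mod_cast h1
    push_cast
    nlinarith
  · have h1 : (4 : ℤ) ≤ (3 * n - 2) ^ 2 := by
      rcases le_or_gt 2 n with h | h
      · nlinarith
      · have : n ≤ 0 := by omega
        nlinarith
    have h1' : (4 : ℝ) ≤ (3 * (n : ℝ) - 2) ^ 2 := by exact_mod_cast h1
    nlinarith [sq_nonneg ((m : ℝ) + n / 2 - 1)]

/-- The mirrored form (lateral offset `+2w`). -/
theorem lateral_form_ge' (m n : ℤ) : (1 : ℝ) / 3 ≤ ((m : ℝ) + n / 2 + 1) ^ 2 + 3 / 4 * ((n : ℝ) + 2 / 3) ^ 2 := by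
  have := lateral_form_ge (-m) (-n)
  push_cast at this
  nlinarith [this]

/-- **hcp reflected through an interlayer nearest neighbour misses hcp by `≥ 1/√3`.** For
`q = barlowPos k i j` and the point `q' = barlowPos (k+1) i j` of the next layer above the same
`(i, j)` (an interlayer nearest neighbour, `dist = 1` at the ideal spacing), the reflected point
`2q' − q` lies in the plane of layer `k + 2` at lateral offset `±2w ∉ ℤu + ℤv` from it: every point
of the hcp stacking is at squared distance `≥ 1/3` from `2q' − q`.  (fcc IS closed under all point
reflections `2p − q`: it is a lattice.) [folklore] -/
theorem hcp_reflection_far (k i j k' i' j' : ℤ) :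
    (1 : ℝ) / 3 ≤ dist (barlowPos 1 hIdeal alternatingHagg k' i' j')
      ((2 : ℝ) • barlowPos 1 hIdeal alternatingHagg (k + 1) i j - barlowPos 1 hIdeal alternatingHagg k i j) ^ 2 := by
  rw [EuclideanSpace.dist_eq, Real.sq_sqrt (by positivity), Fin.sum_univ_three]
  simp only [Real.dist_eq, sq_abs, PiLp.sub_apply, PiLp.smul_apply, smul_eq_mul, barlowPos_apply_zero,
    barlowPos_apply_one, barlowPos_apply_two, one_mul]
  by_cases hk : k' = k + 2
  · subst hk
    have h3 : Real.sqrt 3 ^ 2 = 3 := Real.sq_sqrt (by norm_num)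
    rcases haggLabel_alt_triple k with ⟨h0, h1, h2⟩ | ⟨h0, h1, h2⟩
    · rw [h0, h1, h2]
      push_cast
      have key := lateral_form_ge (i' - i) (j' - j)
      push_cast at key
      have e1 : ((i' : ℝ) + (j' : ℝ) / 2 + 0 / 2 - (2 * ((i : ℝ) + (j : ℝ) / 2 + 1 / 2) - ((i : ℝ) + (j : ℝ) / 2 + 0 / 2)))
          = (i' : ℝ) - i + ((j' : ℝ) - j) / 2 - 1 := by ring
      have e2 : (Real.sqrt 3 / 2 * ((j' : ℝ) + 0 / 3) - (2 * (Real.sqrt 3 / 2 * ((j : ℝ) + 1 / 3)) - Real.sqrt 3 / 2 * ((j : ℝ) + 0 / 3)))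
          = Real.sqrt 3 / 2 * ((j' : ℝ) - j - 2 / 3) := by ring
      have e3 : (((k : ℝ) + 2) * hIdeal - (2 * (((k : ℝ) + 1) * hIdeal) - (k : ℝ) * hIdeal)) = 0 := by ring
      rw [e1, e2, e3, mul_pow, div_pow, h3]
      nlinarith [key]
    · rw [h0, h1, h2]
      push_cast
      have key := lateral_form_ge' (i' - i) (j' - j)
      push_cast at key
      have e1 : ((i' : ℝ) + (j' : ℝ) / 2 + 1 / 2 - (2 * ((i : ℝ) + (j : ℝ) / 2 + 0 / 2) - ((i : ℝ) + (j : ℝ) / 2 + 1 / 2)))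
          = (i' : ℝ) - i + ((j' : ℝ) - j) / 2 + 1 := by ring
      have e2 : (Real.sqrt 3 / 2 * ((j' : ℝ) + 1 / 3) - (2 * (Real.sqrt 3 / 2 * ((j : ℝ) + 0 / 3)) - Real.sqrt 3 / 2 * ((j : ℝ) + 1 / 3)))
          = Real.sqrt 3 / 2 * ((j' : ℝ) - j + 2 / 3) := by ring
      have e3 : (((k : ℝ) + 2) * hIdeal - (2 * (((k : ℝ) + 1) * hIdeal) - (k : ℝ) * hIdeal)) = 0 := by ring
      rw [e1, e2, e3, mul_pow, div_pow, h3]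
      nlinarith [key]
  · -- different plane: vertical distance ≥ hIdeal
    have hz : (1 : ℝ) ≤ ((k' : ℝ) - (k + 2)) ^ 2 := by
      have : (1 : ℤ) ≤ (k' - (k + 2)) ^ 2 := by
        rcases lt_or_gt_of_ne hk with h | h <;> nlinarith
      exact_mod_cast this
    have hsq := hIdeal_sq
    push_cast
    nlinarith [hz, hsq, sq_nonneg ((i' : ℝ) + j' / 2 + (haggLabel alternatingHagg k' : ℝ) / 2 -
        (2 * ((i : ℝ) + j / 2 + (haggLabel alternatingHagg (k + 1) : ℝ) / 2) - ((i : ℝ) + j / 2 + (haggLabel alternatingHagg k : ℝ) / 2))),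
      sq_nonneg (Real.sqrt 3 / 2 * ((j' : ℝ) + (haggLabel alternatingHagg k' : ℝ) / 3) -
        (2 * (Real.sqrt 3 / 2 * ((j : ℝ) + (haggLabel alternatingHagg (k + 1) : ℝ) / 3)) - Real.sqrt 3 / 2 * ((j : ℝ) + (haggLabel alternatingHagg k : ℝ) / 3))),
      mul_pos hIdeal_pos hIdeal_pos]

/-! ### The theorem -/

/-- Ideal interlayer nearest neighbours are at distance `1`. -/
theorem dist_barlowPos_succ_hcp (k i j : ℤ) :
    dist (barlowPos 1 hIdeal alternatingHagg (k + 1) i j) (barlowPos 1 hIdeal alternatingHagg k i j) = 1 := by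
  rw [dist_barlowPos_succ_eq 1 hIdeal isHaggSeq_alternating, hIdeal_sq]; norm_num

/-- **`SqueezeWindow` is FALSE without exact minimality** (`_false_without_IsGroundState` for the line's
transfer target `C⁺`).  Witness: balls of the fcc LATTICE (cubic coordinates, every interior site good
at scale `1` with the identity isometry).  If some sub-ball `B(c', 7)` of an fcc ball were two-way
`1/10`-matched to a rigid image `Y = A G₀(hcp) + t` of a band-strained hcp, pick an fcc point `x_s`
within `6/5` of `c'`, its partner `y_s = A G₀ q + t`, the hcp point `q'` above `q`, its image `y_p` and
partner `x_p`; the fcc point `2x_p − x_s` (fcc is closed under point reflections) is within `0.3` of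
`2y_p − y_s = A G₀ (2q' − q) + t`, hence its partner `y_r ∈ Y` is within `0.4` of the image of `2q' − q`;
pulling back by `(A G₀)⁻¹` (expansion `≤ 20/17`) gives an hcp point within `0.48 < 1/√3` of `2q' − q`,
contradicting `hcp_reflection_far`.  CONSEQUENCE for the line: the hcp-EXACTNESS of `C⁺` is carried
entirely by `IsGroundState` through `stub_windowPinning` + the registry gap `γ' = 10⁻⁵` of
`stub_registryLandscape`; an all-good fcc region of radius `R(ε, r) + 3` in ANY Lennard-Jones ground
state kills `SqueezeWindow`, so the line bets `R(ε, r) ≳` (largest all-good fcc ball in any LJ ground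
state) — physically `~ Δγ_surface/|J₂| ~ 10²–10³` spacings (fcc/Marks-decahedral clusters are the
expected LJ minima up to `N ~ 10⁵–10⁷`), i.e. the squeeze's constant `C_Q/γ'`. [folklore] -/
theorem squeezeWindow_false_without_groundStates : ¬ SqueezeWindowWithoutGroundStates := by
  rintro ⟨G₀, hB, h⟩
  obtain ⟨R, hR7, hR⟩ := h (1 / 10) 7 (by norm_num) (by norm_num)
  set M : ℕ := ⌈R⌉₊ + 6 with hMdef
  have hMR : R + 6 ≤ (M : ℝ) := by
    have := Nat.le_ceil R
    rw [hMdef]; push_cast; linarith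
  have hx := hR (fccBallIdx M).card (fccBall M) (fccBall_injective M) 0
    ⟨(fccBallIdx M).equivFin ⟨0, zero_mem_fccBallIdx M⟩, by
      rw [fccBall_equivFin, fccVec_zero, dist_self]; norm_num⟩
    (fun j hj => good_fccBall j (by rw [dist_zero_right] at hj; linarith))
  obtain ⟨c', A, t, hc', hmatch⟩ := hx
  rw [dist_zero_right] at hc'
  set Y : Set E3 := (fun p => A (G₀ p) + t) '' hcpStacking 1 hIdeal with hYdef
  have hYmem : ∀ k i j : ℤ, A (G₀ (barlowPos 1 hIdeal alternatingHagg k i j)) + t ∈ Y :=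
    fun k i j => ⟨_, barlowPos_mem k i j, rfl⟩
  have hYcases : ∀ y ∈ Y, ∃ k i j : ℤ, y = A (G₀ (barlowPos 1 hIdeal alternatingHagg k i j)) + t := by
    rintro y ⟨p, ⟨k, i, j, rfl⟩, rfl⟩
    exact ⟨k, i, j, rfl⟩
  -- expansion/contraction of the affine map
  have hup : ∀ u : E3, ‖A (G₀ u)‖ ≤ 6 / 5 * ‖u‖ := fun u => by rw [A.norm_map]; exact (hB u).2
  have hlow : ∀ u : E3, 17 / 20 * ‖u‖ ≤ ‖A (G₀ u)‖ := fun u => by rw [A.norm_map]; exact (hB u).1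
  -- Step 1: an fcc point near c'
  obtain ⟨v, hve, hvs⟩ := exists_fccVec_near c'
  have hvM : v ∈ fccBallIdx M := mem_fccBallIdx_of_norm hve (by
    calc ‖fccVec v‖ = ‖(fccVec v - c') + c'‖ := by rw [sub_add_cancel]
      _ ≤ ‖fccVec v - c'‖ + ‖c'‖ := norm_add_le _ _
      _ ≤ M := by linarith)
  have hxs : fccVec v ∈ Set.range (fccBall M) := mem_range_fccBall.2 ⟨v, hvM, rfl⟩
  obtain ⟨ys, hys, hdys⟩ := hmatch.2 (fccVec v) hxs (by rw [dist_eq_norm]; linarith)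
  obtain ⟨k, i, j, rfl⟩ := hYcases ys hys
  set q := barlowPos 1 hIdeal alternatingHagg k i j with hqdef
  set q' := barlowPos 1 hIdeal alternatingHagg (k + 1) i j with hq'def
  -- Step 2: the image of the point above and its partner
  have hyp : A (G₀ q') + t ∈ Y := hYmem (k + 1) i j
  have hdpq : ‖A (G₀ q') + t - (A (G₀ q) + t)‖ ≤ 6 / 5 := by
    have : A (G₀ q') + t - (A (G₀ q) + t) = A (G₀ (q' - q)) := by rw [map_sub, map_sub]; abel
    rw [this]
    calc ‖A (G₀ (q' - q))‖ ≤ 6 / 5 * ‖q' - q‖ := hup _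
      _ = 6 / 5 := by rw [← dist_eq_norm, hq'def, hqdef, dist_barlowPos_succ_hcp]; ring
  rw [dist_eq_norm] at hdys
  obtain ⟨xp, hxp, hdxp⟩ := hmatch.1 _ hyp (by
    rw [dist_eq_norm]
    calc ‖A (G₀ q') + t - c'‖ = ‖(A (G₀ q') + t - (A (G₀ q) + t)) - (fccVec v - (A (G₀ q) + t)) + (fccVec v - c')‖ := by
          congr 1; abel
      _ ≤ ‖A (G₀ q') + t - (A (G₀ q) + t)‖ + ‖fccVec v - (A (G₀ q) + t)‖ + ‖fccVec v - c'‖ :=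
          (norm_add_le _ _).trans (add_le_add (norm_sub_le _ _) le_rfl)
      _ ≤ 7 := by linarith)
  rw [dist_eq_norm] at hdxp
  -- Step 3: reflect
  have hxr_norm : ‖(2 : ℝ) • xp - fccVec v - c'‖ ≤ 32 / 5 := by
    have : (2 : ℝ) • xp - fccVec v - c' =
        (2 : ℝ) • ((xp - (A (G₀ q') + t)) + (A (G₀ q') + t - (A (G₀ q) + t)) + ((A (G₀ q) + t) - fccVec v) + (fccVec v - c'))
          - (fccVec v - c') := by
      simp only [smul_add, smul_sub, two_smul]; abel
    rw [this]
    have h1 : ‖(A (G₀ q) + t) - fccVec v‖ ≤ 1 / 10 := by rw [norm_sub_rev]; exact hdys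
    calc _ ≤ ‖(2 : ℝ) • ((xp - (A (G₀ q') + t)) + (A (G₀ q') + t - (A (G₀ q) + t)) + ((A (G₀ q) + t) - fccVec v) + (fccVec v - c'))‖
          + ‖fccVec v - c'‖ := norm_sub_le _ _
      _ ≤ 2 * (‖xp - (A (G₀ q') + t)‖ + ‖A (G₀ q') + t - (A (G₀ q) + t)‖ + ‖(A (G₀ q) + t) - fccVec v‖ + ‖fccVec v - c'‖)
          + ‖fccVec v - c'‖ := by
          gcongr
          rw [norm_smul, Real.norm_two]
          gcongr
          exact (norm_add_le _ _).trans (add_le_add ((norm_add_le _ _).trans (add_le_add (norm_add_le _ _) le_rfl)) le_rfl)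
      _ ≤ 32 / 5 := by linarith
  have hxr : (2 : ℝ) • xp - fccVec v ∈ Set.range (fccBall M) := by
    refine reflect_mem_range_fccBall hxp hxs ?_
    calc ‖(2 : ℝ) • xp - fccVec v‖ = ‖((2 : ℝ) • xp - fccVec v - c') + c'‖ := by rw [sub_add_cancel]
      _ ≤ ‖(2 : ℝ) • xp - fccVec v - c'‖ + ‖c'‖ := norm_add_le _ _
      _ ≤ M := by linarith
  obtain ⟨yr, hyr, hdyr⟩ := hmatch.2 _ hxr (by rw [dist_eq_norm]; linarith)
  obtain ⟨k'', i'', j'', rfl⟩ := hYcases yr hyr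
  rw [dist_eq_norm] at hdyr
  set q'' := barlowPos 1 hIdeal alternatingHagg k'' i'' j'' with hq''def
  -- Step 4: the pulled-back point is too close to 2q' - q
  have hfar := hcp_reflection_far k i j k'' i'' j''
  rw [← hqdef, ← hq'def, ← hq''def, dist_eq_norm] at hfar
  have himg : A (G₀ q'') + t - ((2 : ℝ) • (A (G₀ q') + t) - (A (G₀ q) + t)) = A (G₀ (q'' - ((2 : ℝ) • q' - q))) := by
    simp only [map_sub, map_add, smul_add, two_smul]; abel
  have hclose : ‖A (G₀ (q'' - ((2 : ℝ) • q' - q)))‖ ≤ 2 / 5 := by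
    rw [← himg]
    have : A (G₀ q'') + t - ((2 : ℝ) • (A (G₀ q') + t) - (A (G₀ q) + t)) =
        (A (G₀ q'') + t - ((2 : ℝ) • xp - fccVec v)) + ((2 : ℝ) • (xp - (A (G₀ q') + t)) - (fccVec v - (A (G₀ q) + t))) := by
      simp only [smul_sub]; abel
    rw [this]
    calc _ ≤ ‖A (G₀ q'') + t - ((2 : ℝ) • xp - fccVec v)‖ + ‖(2 : ℝ) • (xp - (A (G₀ q') + t)) - (fccVec v - (A (G₀ q) + t))‖ :=
          norm_add_le _ _
      _ ≤ ‖A (G₀ q'') + t - ((2 : ℝ) • xp - fccVec v)‖ + (‖(2 : ℝ) • (xp - (A (G₀ q') + t))‖ + ‖fccVec v - (A (G₀ q) + t)‖) := by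
          gcongr; exact norm_sub_le _ _
      _ ≤ 1 / 10 + (2 * (1 / 10) + 1 / 10) := by
          rw [norm_sub_rev (A (G₀ q'') + t), norm_smul, Real.norm_two]
          gcongr
      _ = 2 / 5 := by norm_num
  have hlow' := hlow (q'' - ((2 : ℝ) • q' - q))
  have h1 : ‖q'' - ((2 : ℝ) • q' - q)‖ ≤ 8 / 17 := by linarith
  have h2 : ‖q'' - ((2 : ℝ) • q' - q)‖ ^ 2 ≤ (8 / 17) ^ 2 := pow_le_pow_left₀ (norm_nonneg _) h1 2
  linarith



end Summit.AtomisticToContinuum.Crystallization.Theorems.DefectFreeCrystallizes.Negative.SqueezeWindowNeedsMinimality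

end
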